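import Literature.AnabelianGeometry.EtaleTheta.SettingModelKrullCuspCommTerminal
import Literature.AnabelianGeometry.EtaleTheta.GalSectDotCCuspOfTrivialisation
import Literature.AnabelianGeometry.EtaleTheta.GalSectThm110iiiCuspPairTransport
import HarnessLib

/-!
# Census clause C7d at the `C`-LEVEL: the square root of the cusp generator, a criterion over any `MuTwoSetting`, and the
# verdict at the commutator-axis Krull record `inversionModelκ′` — FAILS for `ε_Z = a`, HOLDS for `ε_Z = a·b`

S. Mochizuki, *The étale theta function …*, Publ. RIMS **45** (2009) [EtTh], Def. 1.7 p. 27 («`Ċ^log` … the quotient of `Ẋ^log` by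
`ε_± · ε_μ`», «a nontrivial element `ε_Z ∈ Gal(Ẍ/X)` which is `≠ ε_μ`»), Thm. 1.10 (iii) p. 30 («the unique cusp of `Ċ^log`»);
[SemiAnbd] Thm. 6.5 (ii) p. 71 («`D_x` is commensurably terminal») [cite: MochizukiEtTh2009, Def 1.7 p.27]. Cell abc-iut, layer L2
(NV lane), seat abc-iut-L2-t5 (gen 7), row R291 part (C). PROOF-ONLY (0 definitions). Consumed BY NAME: abc-iut-w5-d062's
`MuTwoSetting.DotCCusp` and its proposed field C7d `D_commTerminal : ∀ g ∈ M.dotC εZ, Commensurable (g·D·g⁻¹) D → g ∈ D` (= the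
binders `hCTα/hCTβ` of `GalSectThm110iiiCuspPairTransport`), abc-iut-w5-d029's constructor `DotCCusp.ofTrivialisation` /
`dotCCuspκ'OfTrivialisation` (`pair.D = inclX(D_x)`), abc-iut-L2-t10's `MuTwoSetting.inversionModelκ'` (`Π^tp_C = Π^tp_X ⋊_ι ℤ/2`,
`ε_μ = b`, `ε_± = (1, 1̄)`, `ε_Z = a`), this seat's `X`-level theorem `isCommensurablyTerminal_cuspDecompκ` (p447351).

RESULTS.
* §1 (any `M : MuTwoSetting p`, any `H ≤ Π^tp_X`, any `Γ₀ ∈ Π^tp_X` with `ε_± · inclX(d) · ε_±⁻¹ = inclX(Γ₀⁻¹ d Γ₀)` on `H`): the element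
  **`g₁ := inclX(Γ₀) · ε_±` CENTRALISES `inclX(H)`** and is not in it; hence (NEGATIVE) if `g₁ ∈ Π^tp_Ċ = dotC εZ` the C7d shape FAILS
  for `D := inclX(H)`; (POSITIVE) if `H` is commensurably terminal in `Π^tp_X`, `H ≤ Π^tp_Ẍ` and `g₁ ∉ dotC εZ`, the C7d shape HOLDS;
  so **C7d for `inclX(H)` ⇔ `g₁ ∉ Π^tp_Ċ`** (`commTerminalC_iff_sqrt_not_mem_dotC`).
* §2 at `inversionModelκ′`: the inversion acts on the commutator axis by `σ̂(c^t) = (ab)⁻¹ c^t (ab)` (`sigmaHat_cPow`, by density from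
  `σ̂⁅a,b⁆ = ⁅a⁻¹,b⁻¹⁆ = (ab)⁻¹⁅a,b⁆(ab)`), so `Γ₀ = inl(ab)` works for `H = D_x = c^Ẑ ⋊ G_{ℚ_p}`, and `g₁² = inclX(c)`: **`g₁` is a square
  root of the cusp generator** — the generator of the inertia of the cusp of the ORBICURVE `C` (ramification index `2` over `X`).
* §3 verdict: `g₁ ∈ dotC εZ` iff `ε_Z ≡ a (mod Π^tp_Ẍ)`; hence **C7d FAILS at `(inversionModelκ′, ε_Z = a)`** (the model's declared,
  admissible `epsZInvκ`: `not_commTerminalC_inversionModelκ'_epsZInvκ`, also for the `DotCCusp` term `dotCCuspκ'OfTrivialisation`) and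
  **HOLDS at `(inversionModelκ′, ε_Z = a·b)`** (also admissible: `isAdmissibleEpsZ_abκ`, `commTerminalC_inversionModelκ'_epsZab`).

READING (numbers, not taste). C7d is neither vacuous nor contradictory at the commutator-axis carrier: it detects whether the model's
`Ċ = Ẋ/⟨ε_± ε_μ⟩` is UNRAMIFIED at the cusp (print: «the unique cusp of `Ċ`» — the two cusps of `Ẋ` are swapped) or ramified (then
`inclX(D_x)` is an index-`2` subgroup of the true decomposition group `⟨inclX(D_x), g₁⟩` and is not commensurably terminal). The typed
`IsAdmissibleEpsZ` (`ε_Z ∈ Gal(Ẍ/X) ∖ {1, ε_μ}`) does not fix this, because the interface does not tie `ε_±` to the cusp (print's `ε_±`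
lifts `[−1]`, which FIXES the `2`-torsion cusps of `Ẍ`; the model's `ε_± = (1, 1̄)` fixes none — `g₁ = inl(ab)·ε_±` does). SEMI-SYNTHETIC
model, consistency evidence only; nothing of [EtTh]/[SemiAnbd] asserted; no side taken on [IUTchIII] Cor. 3.12; typed ≠ proved.
-/

noncomputable section

open scoped Pointwise

namespace Literature.AnabelianGeometry.EtaleTheta

open Literature.AnabelianGeometry.SemiGraphs Literature.AnabelianGeometry.AbsoluteAnabelian
open Function _root_.Topology
open scoped commutatorElement

/-! ## §1. Over any `MuTwoSetting`: the centralising element `inclX(Γ₀) · ε_±` and the C7d criterion -/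

namespace MuTwoSetting

variable {p : ℕ} [Fact p.Prime] (M : MuTwoSetting p)

/-- `Π^tp_C = inclX(Π^tp_X) ⊔ inclX(Π^tp_X)·ε_±` (index `2`, `ε_± ∉ inclX(Π^tp_X)`): every `g ∈ Π^tp_C` lies over `X` or is `inclX(h)·ε_±`.
[cite: MochizukiEtTh2009, Def 1.7 p.27] -/
theorem mem_range_inclX_or_mul_epsPM_inv_mem (g : M.GtpC) : g ∈ M.inclX.range ∨ g * M.epsPM⁻¹ ∈ M.inclX.range := by
  by_cases hg : g ∈ M.inclX.range
  · exact Or.inl hg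
  · refine Or.inr ((Subgroup.mul_mem_iff_of_index_two M.index_range_inclX).mpr ?_)
    have hε : M.epsPM⁻¹ ∉ M.inclX.range := fun h => M.epsPM_not_mem (by simpa using M.inclX.range.inv_mem h)
    exact ⟨fun h => (hg h).elim, fun h => (hε h).elim⟩

variable {M} {H : Subgroup M.PiTemp} {Γ₀ : M.PiTemp}

/-- **`g₁ := inclX(Γ₀)·ε_±` CENTRALISES `inclX(H)`** when `ε_±` conjugates `inclX(d)` to `inclX(Γ₀⁻¹ d Γ₀)` on `H`.
[cite: MochizukiEtTh2009, §2 p.36] -/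
theorem sqrt_conj_inclX_eq (hΓ₀ : ∀ d ∈ H, M.epsPM * M.inclX d * M.epsPM⁻¹ = M.inclX (Γ₀⁻¹ * d * Γ₀)) {d : M.PiTemp} (hd : d ∈ H) :
    (M.inclX Γ₀ * M.epsPM) * M.inclX d * (M.inclX Γ₀ * M.epsPM)⁻¹ = M.inclX d := by
  calc (M.inclX Γ₀ * M.epsPM) * M.inclX d * (M.inclX Γ₀ * M.epsPM)⁻¹
      = M.inclX Γ₀ * (M.epsPM * M.inclX d * M.epsPM⁻¹) * (M.inclX Γ₀)⁻¹ := by group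
    _ = M.inclX d := by rw [hΓ₀ d hd, ← map_inv, ← map_mul, ← map_mul]; congr 1; group

/-- Hence `g₁·inclX(H)·g₁⁻¹ = inclX(H)`. [cite: MochizukiEtTh2009, §2 p.36] -/
theorem sqrt_conj_smul_map_inclX (hΓ₀ : ∀ d ∈ H, M.epsPM * M.inclX d * M.epsPM⁻¹ = M.inclX (Γ₀⁻¹ * d * Γ₀)) :
    MulAut.conj (M.inclX Γ₀ * M.epsPM) • H.map M.inclX = H.map M.inclX := by
  ext x
  rw [Subgroup.mem_smul_pointwise_iff_exists]
  constructor
  · rintro ⟨_, ⟨d, hd, rfl⟩, rfl⟩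
    rw [MulAut.smul_def, MulAut.conj_apply, sqrt_conj_inclX_eq hΓ₀ hd]
    exact ⟨d, hd, rfl⟩
  · rintro ⟨d, hd, rfl⟩
    exact ⟨M.inclX d, ⟨d, hd, rfl⟩, by rw [MulAut.smul_def, MulAut.conj_apply, sqrt_conj_inclX_eq hΓ₀ hd]⟩

/-- `ε_±·inclX(H)·ε_±⁻¹ = inclX(Γ₀⁻¹·H·Γ₀)`. [cite: MochizukiEtTh2009, §2 p.36] -/
theorem epsPM_conj_smul_map_inclX (hΓ₀ : ∀ d ∈ H, M.epsPM * M.inclX d * M.epsPM⁻¹ = M.inclX (Γ₀⁻¹ * d * Γ₀)) :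
    MulAut.conj M.epsPM • H.map M.inclX = (MulAut.conj Γ₀⁻¹ • H).map M.inclX := by
  ext x
  rw [Subgroup.mem_smul_pointwise_iff_exists, Subgroup.mem_map]
  constructor
  · rintro ⟨_, ⟨d, hd, rfl⟩, rfl⟩
    refine ⟨Γ₀⁻¹ * d * Γ₀, ?_, ?_⟩
    · rw [Subgroup.mem_smul_pointwise_iff_exists]
      exact ⟨d, hd, by rw [MulAut.smul_def, MulAut.conj_apply, inv_inv]⟩
    · rw [MulAut.smul_def, MulAut.conj_apply, hΓ₀ d hd]
  · rintro ⟨y, hy, rfl⟩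
    rw [Subgroup.mem_smul_pointwise_iff_exists] at hy
    obtain ⟨d, hd, rfl⟩ := hy
    refine ⟨M.inclX d, ⟨d, hd, rfl⟩, ?_⟩
    rw [MulAut.smul_def, MulAut.conj_apply, hΓ₀ d hd, MulAut.smul_def, MulAut.conj_apply, inv_inv]

variable (H Γ₀) in
/-- `g₁ ∉ inclX(H)` (it does not even lie over `X`). [cite: MochizukiEtTh2009, Def 1.7 p.27] -/
theorem sqrt_not_mem_map_inclX : M.inclX Γ₀ * M.epsPM ∉ H.map M.inclX := by
  rintro ⟨d, -, hd⟩
  apply M.epsPM_not_mem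
  refine ⟨Γ₀⁻¹ * d, ?_⟩
  rw [map_mul, map_inv, hd, inv_mul_cancel_left]

/-- **NEGATIVE half of the criterion**: if `g₁ = inclX(Γ₀)·ε_± ∈ Π^tp_Ċ`, the C7d shape FAILS for `D := inclX(H)` (`g₁` normalises —
indeed centralises — `D` without belonging to it). [cite: MochizukiSemiAnbd2006, Thm 6.5 (ii) p.71] -/
theorem not_commTerminalC_of_sqrt_mem_dotC (hΓ₀ : ∀ d ∈ H, M.epsPM * M.inclX d * M.epsPM⁻¹ = M.inclX (Γ₀⁻¹ * d * Γ₀))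
    {εZ : M.GtpC} (hmem : M.inclX Γ₀ * M.epsPM ∈ M.dotC εZ) :
    ¬ ∀ g ∈ M.dotC εZ, Subgroup.Commensurable (MulAut.conj g • H.map M.inclX) (H.map M.inclX) → g ∈ H.map M.inclX := fun h =>
  sqrt_not_mem_map_inclX H Γ₀ (h _ hmem (by rw [sqrt_conj_smul_map_inclX hΓ₀]))

/-- Commensurability of images under the injective `inclX` is commensurability in `Π^tp_X`. [cite: MochizukiAbsAnab2004, Def 0.1 (iii) p.4] -/
theorem commensurable_map_inclX_iff {A B : Subgroup M.PiTemp} :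
    Subgroup.Commensurable (A.map M.inclX) (B.map M.inclX) ↔ Subgroup.Commensurable A B :=
  commensurable_map_iff_of_injective M.injective_inclX

/-- **POSITIVE half of the criterion**: if `H` is commensurably terminal in `Π^tp_X`, `H ≤ Π^tp_Ẍ`, and `g₁ ∉ Π^tp_Ċ`, then the C7d shape
HOLDS for `D := inclX(H)` over `Π^tp_Ċ = dotC εZ`: an element over `X` reduces to the `X`-level; an element `inclX(h)·ε_±` conjugates `D`
to `inclX(hΓ₀⁻¹·H·Γ₀h⁻¹)`, commensurable with `D` only if `hΓ₀⁻¹ ∈ H`, which would put `g₁` in `Π^tp_Ċ`.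
[cite: MochizukiSemiAnbd2006, Thm 6.5 (ii) p.71] -/
theorem commTerminalC_of_sqrt_not_mem_dotC (hCT : IsCommensurablyTerminal H)
    (hΓ₀ : ∀ d ∈ H, M.epsPM * M.inclX d * M.epsPM⁻¹ = M.inclX (Γ₀⁻¹ * d * Γ₀)) (hHX : H ≤ M.GtpXdd)
    {εZ : M.GtpC} (hnot : M.inclX Γ₀ * M.epsPM ∉ M.dotC εZ) :
    ∀ g ∈ M.dotC εZ, Subgroup.Commensurable (MulAut.conj g • H.map M.inclX) (H.map M.inclX) → g ∈ H.map M.inclX := by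
  intro g hg hc
  rcases M.mem_range_inclX_or_mul_epsPM_inv_mem g with ⟨h, rfl⟩ | ⟨h, hh⟩
  · -- over `X`
    rw [← Literature.IUT.HodgeTheaters.map_conj_smul, commensurable_map_inclX_iff] at hc
    exact ⟨h, SettingModel.mem_of_isCommensurablyTerminal hCT hc, rfl⟩
  · -- `g = inclX(h) · ε_±`
    have hg' : g = M.inclX h * M.epsPM := by rw [hh, inv_mul_cancel_right]
    rw [hg', map_mul, mul_smul, epsPM_conj_smul_map_inclX hΓ₀, ← Literature.IUT.HodgeTheaters.map_conj_smul, ← mul_smul,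
      ← map_mul, commensurable_map_inclX_iff] at hc
    have hmem : h * Γ₀⁻¹ ∈ H := SettingModel.mem_of_isCommensurablyTerminal hCT hc
    exfalso
    apply hnot
    have hD : M.inclX (h * Γ₀⁻¹) ∈ M.dotC εZ :=
      (M.map_GtpXdd_le_dotX εZ).trans (M.dotX_le_dotC εZ) ⟨_, hHX hmem, rfl⟩
    have key : M.inclX Γ₀ * M.epsPM = (M.inclX (h * Γ₀⁻¹))⁻¹ * g := by
      rw [hg', map_mul, map_inv]; group
    rw [key]
    exact (M.dotC εZ).mul_mem ((M.dotC εZ).inv_mem hD) hg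

/-- **THE C7d CRITERION** for `D := inclX(H)` (`H` commensurably terminal in `Π^tp_X`, `H ≤ Π^tp_Ẍ`): the clause holds over `Π^tp_Ċ = dotC εZ`
IFF the centralising element `g₁ = inclX(Γ₀)·ε_±` is NOT in `Π^tp_Ċ`. [cite: MochizukiSemiAnbd2006, Thm 6.5 (ii) p.71] -/
theorem commTerminalC_iff_sqrt_not_mem_dotC (hCT : IsCommensurablyTerminal H)
    (hΓ₀ : ∀ d ∈ H, M.epsPM * M.inclX d * M.epsPM⁻¹ = M.inclX (Γ₀⁻¹ * d * Γ₀)) (hHX : H ≤ M.GtpXdd) (εZ : M.GtpC) :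
    (∀ g ∈ M.dotC εZ, Subgroup.Commensurable (MulAut.conj g • H.map M.inclX) (H.map M.inclX) → g ∈ H.map M.inclX) ↔
      M.inclX Γ₀ * M.epsPM ∉ M.dotC εZ :=
  ⟨fun h hmem => not_commTerminalC_of_sqrt_mem_dotC hΓ₀ hmem h, commTerminalC_of_sqrt_not_mem_dotC hCT hΓ₀ hHX⟩

end MuTwoSetting

/-! ## §2. At `inversionModelκ′`: the inversion on the commutator axis and the square root of the cusp generator -/

namespace SettingModel

variable (p : ℕ) [Fact p.Prime]

/-- `gfpOf` is multiplicative (both coordinates are homomorphisms). [cite: MochizukiEtTh2009, §1 p.12] -/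
theorem gfpOf_mul (g h : F₂) : gfpOf (g * h) = gfpOf g * gfpOf h :=
  Subtype.ext (Prod.ext (map_mul eta g h) (map_mul expA g h))

/-- [cite: MochizukiEtTh2009, §1 p.12] -/
theorem gfpOf_inv (g : F₂) : gfpOf g⁻¹ = (gfpOf g)⁻¹ :=
  Subtype.ext (Prod.ext (map_inv eta g) (map_inv expA g))

/-- `pr₁ (gfpOf g) = η g`. [cite: MochizukiEtTh2009, §1 p.12] -/
theorem gfpFst_gfpOf (g : F₂) : gfpFst (gfpOf g) = eta g := rfl

/-- **The inversion on the graph elements**: `ι_Γ (gfpOf g) = gfpOf (σ g)` (`σ : a ↦ a⁻¹, b ↦ b⁻¹`).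
[cite: MochizukiEtTh2009, §2 p.36] -/
theorem gfpInv_gfpOf (g : F₂) : gfpInv (gfpOf g) = gfpOf (invGenHom g) :=
  Subtype.ext (Prod.ext (sigmaHat_eta g) (by
    change (expA g)⁻¹ = expA (invGenHom g)
    rw [hom_invGenHom]))

/-- In `F₂`: `σ⁅a,b⁆ = ⁅a⁻¹,b⁻¹⁆ = (ab)⁻¹ ⁅a,b⁆ (ab)`. [cite: MochizukiEtTh2009, §2 p.36] -/
theorem invGenHom_cElt : invGenHom cElt = (FreeGroup.of 0 * FreeGroup.of 1)⁻¹ * cElt * (FreeGroup.of 0 * FreeGroup.of 1) := by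
  rw [cElt, map_commutatorElement, invGenHom_of, invGenHom_of, commutatorElement_def, commutatorElement_def]
  group

/-- **`σ̂(c^t) = (ab)⁻¹ · c^t · (ab)`**: the completed inversion conjugates the commutator axis by `η(ab)` (two continuous homomorphisms
`Ẑ → F̂₂` agreeing at `ι 1`). [cite: MochizukiEtTh2009, §2 p.36] -/
theorem sigmaHat_cPow (t : ZH) :
    sigmaHat (cPow t) = (eta (FreeGroup.of 0 * FreeGroup.of 1))⁻¹ * cPow t * eta (FreeGroup.of 0 * FreeGroup.of 1) := by
  have h := ZHatCompletion.monoidHom_ext_of_continuous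
    (f₁ := sigmaHat.toMonoidHom.comp cPow.toMonoidHom)
    (f₂ := (MulAut.conj (eta (FreeGroup.of 0 * FreeGroup.of 1))⁻¹).toMonoidHom.comp cPow.toMonoidHom)
    (sigmaHat.continuous.comp cPow.continuous)
    (by
      change Continuous fun t => (MulAut.conj (eta (FreeGroup.of 0 * FreeGroup.of 1))⁻¹) (cPow t)
      simp only [map_inv, MulAut.conj_inv_apply]
      exact (continuous_const.mul cPow.continuous).mul continuous_const)
    (by
      change sigmaHat (cPow (iotaZ (Multiplicative.ofAdd 1))) =
        (MulAut.conj (eta (FreeGroup.of 0 * FreeGroup.of 1)))⁻¹ (cPow (iotaZ (Multiplicative.ofAdd 1)))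
      rw [cPow_spec, sigmaHat_eta, invGenHom_cElt, MulAut.conj_inv_apply, map_mul eta, map_mul eta, map_inv eta])
  have ht := DFunLike.congr_fun h t
  change sigmaHat (cPow t) = (MulAut.conj (eta (FreeGroup.of 0 * FreeGroup.of 1)))⁻¹ (cPow t) at ht
  rw [ht, MulAut.conj_inv_apply]

/-- **`ι_Γ(c^t) = (ab)⁻¹ c^t (ab)` in `Γ`**. [cite: MochizukiEtTh2009, §2 p.36] -/
theorem gfpInv_cPowGfp (t : ZH) :
    gfpInv (cPowGfp t) = (gfpOf (FreeGroup.of 0 * FreeGroup.of 1))⁻¹ * cPowGfp t * gfpOf (FreeGroup.of 0 * FreeGroup.of 1) := by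
  apply gfpFst_injective
  rw [map_mul, map_mul, map_inv, gfpFst_gfpOf, gfpFst_cPowGfp]
  change sigmaHat (cPow t) = _
  exact sigmaHat_cPow t

/-- **The twisted inversion on `D_x = c^Ẑ ⋊ G_{ℚ_p}` is conjugation by `inl(ab)⁻¹`** (trivial action: `inr σ` commutes with `inl`).
[cite: MochizukiEtTh2009, §2 p.36] -/
theorem twistedInversion_eq_conj_of_mem_cuspDecompκ {d : PiTpκ p} (hd : d ∈ cuspDecompκ p) :
    twistedInversion (1 : GQp p →* MulAut ZH) d =
      (SemidirectProduct.inl (gfpOf (FreeGroup.of 0 * FreeGroup.of 1)))⁻¹ * d *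
        SemidirectProduct.inl (gfpOf (FreeGroup.of 0 * FreeGroup.of 1)) := by
  obtain ⟨t, ht'⟩ := (mem_cuspDecompκ_iff p d).mp hd
  have ht : cPowGfp t = d.left := ht'
  refine SemidirectProduct.ext ?_ ?_
  · rw [twistedInversion_left, ← ht, gfpInv_cPowGfp]
    simp only [SemidirectProduct.mul_left, SemidirectProduct.inv_left, SemidirectProduct.left_inl,
      SemidirectProduct.right_inl, actκ_apply_eq, ht]
  · simp only [twistedInversion_right, SemidirectProduct.mul_right, SemidirectProduct.inv_right,
      SemidirectProduct.right_inl, inv_one, one_mul, mul_one]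

/-- **`ε_± · inclX(d) · ε_±⁻¹ = inclX(inl(ab)⁻¹ · d · inl(ab))` for `d ∈ D_x`** at `inversionModelκ′` (the hypothesis `hΓ₀` of §1 with
`Γ₀ = inl(ab)`). [cite: MochizukiEtTh2009, §2 p.36] -/
theorem epsPM_conj_inclX_of_mem_cuspDecompκ :
    ∀ d ∈ cuspDecompκ p, (MuTwoSetting.inversionModelκ' p).epsPM * (MuTwoSetting.inversionModelκ' p).inclX d *
        (MuTwoSetting.inversionModelκ' p).epsPM⁻¹ =
      (MuTwoSetting.inversionModelκ' p).inclX
        ((SemidirectProduct.inl (gfpOf (FreeGroup.of 0 * FreeGroup.of 1)))⁻¹ * d *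
          SemidirectProduct.inl (gfpOf (FreeGroup.of 0 * FreeGroup.of 1))) := fun d hd => by
  rw [MuTwoSetting.inversionModelκ'_epsPM_conj, twistedInversionTop_apply, twistedInversion_eq_conj_of_mem_cuspDecompκ p hd]

/-- **`g₁² = inclX(c)`**: `g₁ := inclX(inl(ab))·ε_±` is a SQUARE ROOT of (the image of) the cusp generator `inl(gfpOf ⁅a,b⁆)` — the inertia
generator of the cusp of the orbicurve `C = X/±1` (ramification index `2`). [cite: MochizukiEtTh2009, Def 1.7 p.27] -/
theorem sqrtCuspκ_sq :
    ((MuTwoSetting.inversionModelκ' p).inclX (SemidirectProduct.inl (gfpOf (FreeGroup.of 0 * FreeGroup.of 1))) *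
        (MuTwoSetting.inversionModelκ' p).epsPM) ^ 2 =
      (MuTwoSetting.inversionModelκ' p).inclX (SemidirectProduct.inl (gfpOf cElt)) := by
  set M := MuTwoSetting.inversionModelκ' p
  set γ := (SemidirectProduct.inl (gfpOf (FreeGroup.of 0 * FreeGroup.of 1)) : PiTpκ p)
  have hconj : M.epsPM * M.inclX γ * M.epsPM⁻¹ = M.inclX (SemidirectProduct.inl (gfpOf (invGenHom (FreeGroup.of 0 * FreeGroup.of 1)))) := by
    rw [MuTwoSetting.inversionModelκ'_epsPM_conj, twistedInversionTop_apply, twistedInversion_inl, gfpInv_gfpOf]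
  have hsq : M.epsPM * M.epsPM = 1 := by
    change epsPMInvκ p * epsPMInvκ p = 1
    rw [epsPMInvκ, ← map_mul]
    have h1 : Multiplicative.ofAdd (1 : ZMod 2) * Multiplicative.ofAdd (1 : ZMod 2) = 1 := by decide
    rw [h1, map_one]
  calc (M.inclX γ * M.epsPM) ^ 2 = M.inclX γ * (M.epsPM * M.inclX γ * M.epsPM⁻¹) * (M.epsPM * M.epsPM) := by
        rw [pow_two]; group
    _ = M.inclX (γ * SemidirectProduct.inl (gfpOf (invGenHom (FreeGroup.of 0 * FreeGroup.of 1)))) := by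
        rw [hconj, hsq, mul_one, ← map_mul]
    _ = M.inclX (SemidirectProduct.inl (gfpOf cElt)) := by
        rw [← map_mul, ← gfpOf_mul, map_mul invGenHom, invGenHom_of, invGenHom_of, cElt, commutatorElement_def]
        simp only [mul_assoc]

/-! ## §3. The verdict: `g₁ ∈ Π^tp_Ċ` iff `ε_Z ≡ a`; C7d FAILS for `ε_Z = a`, HOLDS for `ε_Z = a·b` -/

/-- Parities of graph words: `inl(gfpOf g) ∈ Π^tp_Ẍ` iff the `a`- and `b`-exponent sums of `g` are even.
[cite: MochizukiEtTh2009, Def 1.7 p.27] -/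
theorem inl_gfpOf_mem_Xddκ_iff (g : F₂) :
    (SemidirectProduct.inl (gfpOf g) : PiTpκ p) ∈ Xddκ p ↔
      (((heisHom g).x : ℤ) : ZMod ((2 : ℕ+) : ℕ)) = 0 ∧ (((heisHom g).y : ℤ) : ZMod ((2 : ℕ+) : ℕ)) = 0 := by
  rw [Xddκ, MonoidHom.mem_ker, parityκ_inl, xyTwo_gfpOf, Prod.mk_eq_one]
  exact Iff.rfl

/-- `a·b² ∉ Π^tp_Ẍ` (parity `(1,0)`). [cite: MochizukiEtTh2009, Def 1.7 p.27] -/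
theorem inl_gfpOf_abb_not_mem_Xddκ :
    (SemidirectProduct.inl (gfpOf (FreeGroup.of 0 * FreeGroup.of 1 * FreeGroup.of 1)) : PiTpκ p) ∉ Xddκ p := by
  rw [inl_gfpOf_mem_Xddκ_iff]
  simp only [map_mul, heisHom_of_zero, heisHom_of_one, Heis.mul_x, Heis.mul_y]
  decide

/-- `a·b²·a⁻¹ ∈ Π^tp_Ẍ` (parity `(0,0)`). [cite: MochizukiEtTh2009, Def 1.7 p.27] -/
theorem inl_gfpOf_abba_mem_Xddκ :
    (SemidirectProduct.inl (gfpOf (FreeGroup.of 0 * FreeGroup.of 1 * FreeGroup.of 1 * (FreeGroup.of 0)⁻¹)) : PiTpκ p) ∈ Xddκ p := by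
  rw [inl_gfpOf_mem_Xddκ_iff]
  simp only [map_mul, map_inv, heisHom_of_zero, heisHom_of_one, Heis.mul_x, Heis.mul_y, Heis.inv_x, Heis.inv_y]
  decide

/-- `a·b²·(ab)⁻¹ = a·b·a⁻¹ ∉ Π^tp_Ẍ` (parity `(0,1)`). [cite: MochizukiEtTh2009, Def 1.7 p.27] -/
theorem inl_gfpOf_abb_ab_inv_not_mem_Xddκ :
    (SemidirectProduct.inl (gfpOf (FreeGroup.of 0 * FreeGroup.of 1 * FreeGroup.of 1 * (FreeGroup.of 0 * FreeGroup.of 1)⁻¹)) :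
      PiTpκ p) ∉ Xddκ p := by
  rw [inl_gfpOf_mem_Xddκ_iff]
  simp only [map_mul, map_inv, heisHom_of_zero, heisHom_of_one, Heis.mul_x, Heis.mul_y, Heis.inv_x, Heis.inv_y]
  decide

/-- `a·b ∉ Π^tp_Ẍ` (parity `(1,1)`). [cite: MochizukiEtTh2009, Def 1.7 p.27] -/
theorem inl_gfpOf_ab_not_mem_Xddκ :
    (SemidirectProduct.inl (gfpOf (FreeGroup.of 0 * FreeGroup.of 1)) : PiTpκ p) ∉ Xddκ p := by
  rw [inl_gfpOf_mem_Xddκ_iff]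
  simp only [map_mul, heisHom_of_zero, heisHom_of_one, Heis.mul_x, Heis.mul_y]
  decide

/-- `g₁ · (ε_± ε_μ)⁻¹ = inclX(inl(a·b²))` at `inversionModelκ′` (`ε_μ = inl b`, `ε_± inclX(b) ε_±⁻¹ = inclX(b⁻¹)`).
[cite: MochizukiEtTh2009, Def 1.7 p.27] -/
theorem sqrtCuspκ_mul_inv_epsPM_epsMu :
    (MuTwoSetting.inversionModelκ' p).inclX (SemidirectProduct.inl (gfpOf (FreeGroup.of 0 * FreeGroup.of 1))) *
          (MuTwoSetting.inversionModelκ' p).epsPM *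
        ((MuTwoSetting.inversionModelκ' p).epsPM * (MuTwoSetting.inversionModelκ' p).epsMu)⁻¹ =
      (MuTwoSetting.inversionModelκ' p).inclX (SemidirectProduct.inl (gfpOf (FreeGroup.of 0 * FreeGroup.of 1 * FreeGroup.of 1))) := by
  set M := MuTwoSetting.inversionModelκ' p
  have hμ : M.epsMu = M.inclX (SemidirectProduct.inl (gfpOf (FreeGroup.of 1))) := rfl
  have hconj : M.epsPM * M.inclX (SemidirectProduct.inl (gfpOf (FreeGroup.of 1))) * M.epsPM⁻¹ =
      M.inclX (SemidirectProduct.inl (gfpOf (FreeGroup.of 1)⁻¹)) := by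
    rw [MuTwoSetting.inversionModelκ'_epsPM_conj, twistedInversionTop_apply, twistedInversion_inl, gfpInv_gfpOf, invGenHom_of]
  calc M.inclX (SemidirectProduct.inl (gfpOf (FreeGroup.of 0 * FreeGroup.of 1))) * M.epsPM * (M.epsPM * M.epsMu)⁻¹
      = M.inclX (SemidirectProduct.inl (gfpOf (FreeGroup.of 0 * FreeGroup.of 1))) *
          (M.epsPM * M.inclX (SemidirectProduct.inl (gfpOf (FreeGroup.of 1))) * M.epsPM⁻¹)⁻¹ := by rw [hμ]; group
    _ = M.inclX (SemidirectProduct.inl (gfpOf (FreeGroup.of 0 * FreeGroup.of 1 * FreeGroup.of 1))) := by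
        rw [hconj, ← map_inv, ← map_mul, ← map_inv, ← map_mul, gfpOf_inv, inv_inv, ← gfpOf_mul]

/-- **`g₁ ∈ Π^tp_Ċ` for the model's `ε_Z = a`** (`g₁ = ε_Z · inclX(b²·…) · (ε_± ε_μ)` with `a·b²·a⁻¹ ∈ Π^tp_Ẍ`).
[cite: MochizukiEtTh2009, Def 1.7 p.27] -/
theorem sqrtCuspκ_mem_dotC_epsZInvκ :
    (MuTwoSetting.inversionModelκ' p).inclX (SemidirectProduct.inl (gfpOf (FreeGroup.of 0 * FreeGroup.of 1))) *
        (MuTwoSetting.inversionModelκ' p).epsPM ∈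
      (MuTwoSetting.inversionModelκ' p).dotC (epsZInvκ p) := by
  set M := MuTwoSetting.inversionModelκ' p
  rw [M.mem_dotC_iff]
  refine Or.inr ?_
  rw [sqrtCuspκ_mul_inv_epsPM_epsMu, M.mem_dotX_iff]
  refine Or.inr ⟨SemidirectProduct.inl (gfpOf (FreeGroup.of 0 * FreeGroup.of 1 * FreeGroup.of 1 * (FreeGroup.of 0)⁻¹)),
    inl_gfpOf_abba_mem_Xddκ p, ?_⟩
  change inclInvκ p _ = inclInvκ p _ * (inclInvκ p (SemidirectProduct.inl (gfpOf (FreeGroup.of 0))))⁻¹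
  rw [← map_inv, ← map_mul, ← map_inv, ← map_mul, ← gfpOf_inv, ← gfpOf_mul]

/-- **`ε_Z := a·b` is admissible** at `inversionModelκ′` (`ab ∈ Π^tp_X`, `ab ∉ Π^tp_Ẍ`, `ab·b⁻¹ = a ∉ Π^tp_Ẍ`).
[cite: MochizukiEtTh2009, Def 1.7 p.27] -/
theorem isAdmissibleEpsZ_abκ :
    (MuTwoSetting.inversionModelκ' p).IsAdmissibleEpsZ
      ((MuTwoSetting.inversionModelκ' p).inclX (SemidirectProduct.inl (gfpOf (FreeGroup.of 0 * FreeGroup.of 1)))) := by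
  refine ⟨⟨_, rfl⟩, ?_, ?_⟩
  · rintro ⟨y, hy, hyy⟩
    have h := SemidirectProduct.inl_injective hyy
    subst h
    exact inl_gfpOf_ab_not_mem_Xddκ p hy
  · change inclInvκ p (SemidirectProduct.inl (gfpOf (FreeGroup.of 0 * FreeGroup.of 1))) *
        (inclInvκ p (SemidirectProduct.inl (gfpOf (FreeGroup.of 1))))⁻¹ ∉ (Xddκ p).map (inclInvκ p)
    rw [← map_inv, ← map_mul, ← map_inv, ← map_mul, ← gfpOf_inv, ← gfpOf_mul, mul_inv_cancel_right]
    rintro ⟨y, hy, hyy⟩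
    have h := SemidirectProduct.inl_injective hyy
    subst h
    exact inl_gfpOf_zero_not_mem_Xddκ p hy

/-- **`g₁ ∉ Π^tp_Ċ` for `ε_Z = a·b`** (`g₁ ∉ Π^tp_Ẋ ⊆ inclX(Π^tp_X)`, and `g₁(ε_±ε_μ)⁻¹ = inclX(ab²)` has `ab² ∉ Π^tp_Ẍ` and
`ab²·(ab)⁻¹ = aba⁻¹ ∉ Π^tp_Ẍ`). [cite: MochizukiEtTh2009, Def 1.7 p.27] -/
theorem sqrtCuspκ_not_mem_dotC_epsZab :
    (MuTwoSetting.inversionModelκ' p).inclX (SemidirectProduct.inl (gfpOf (FreeGroup.of 0 * FreeGroup.of 1))) *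
        (MuTwoSetting.inversionModelκ' p).epsPM ∉
      (MuTwoSetting.inversionModelκ' p).dotC
        ((MuTwoSetting.inversionModelκ' p).inclX (SemidirectProduct.inl (gfpOf (FreeGroup.of 0 * FreeGroup.of 1)))) := by
  set M := MuTwoSetting.inversionModelκ' p
  intro h
  rw [M.mem_dotC_iff] at h
  rcases h with h | h
  · have h1 : M.inclX (SemidirectProduct.inl (gfpOf (FreeGroup.of 0 * FreeGroup.of 1))) * M.epsPM ∈ M.inclX.range :=
      M.dotX_le_range (isAdmissibleEpsZ_abκ p) h
    rw [MonoidHom.range_eq_map] at h1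
    exact MuTwoSetting.sqrt_not_mem_map_inclX ⊤ _ h1
  · rw [sqrtCuspκ_mul_inv_epsPM_epsMu, M.mem_dotX_iff] at h
    rcases h with ⟨y, hy, hyy⟩ | ⟨y, hy, hyy⟩
    · have h := SemidirectProduct.inl_injective hyy
      subst h
      exact inl_gfpOf_abb_not_mem_Xddκ p hy
    · change inclInvκ p y = inclInvκ p _ * (inclInvκ p _)⁻¹ at hyy
      rw [← map_inv, ← map_mul, ← map_inv, ← map_mul, ← gfpOf_inv, ← gfpOf_mul] at hyy
      have h := SemidirectProduct.inl_injective hyy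
      subst h
      exact inl_gfpOf_abb_ab_inv_not_mem_Xddκ p hy

/-- **C7d FAILS at `(inversionModelκ′, ε_Z = a)` for `D := inclX(D_x)`** (the pair of abc-iut-w5-d029's `dotCCuspκ'OfTrivialisation`):
`g₁ = inclX(inl(ab))·ε_± ∈ Π^tp_Ċ` centralises `D` and is not in it. [cite: MochizukiSemiAnbd2006, Thm 6.5 (ii) p.71] -/
theorem not_commTerminalC_inversionModelκ'_epsZInvκ :
    ¬ ∀ g ∈ (MuTwoSetting.inversionModelκ' p).dotC (epsZInvκ p),
        Subgroup.Commensurable (MulAut.conj g • (cuspDecompκ p).map (MuTwoSetting.inversionModelκ' p).inclX)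
            ((cuspDecompκ p).map (MuTwoSetting.inversionModelκ' p).inclX) →
          g ∈ (cuspDecompκ p).map (MuTwoSetting.inversionModelκ' p).inclX :=
  MuTwoSetting.not_commTerminalC_of_sqrt_mem_dotC (epsPM_conj_inclX_of_mem_cuspDecompκ p) (sqrtCuspκ_mem_dotC_epsZInvκ p)

/-- The same for the `DotCCusp` TERM `dotCCuspκ'OfTrivialisation p (epsZInvκ p) eK` (any trivialisation `eK`): its `pair.D` violates the
proposed field C7d. [cite: MochizukiEtTh2009, Thm 1.10 (iii) p.30] -/
theorem not_commTerminalC_dotCCuspκ'OfTrivialisation_epsZInvκ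
    (eK : ((GalSect.cuspPairOf (curveκ' p) ()).pushforward (inclInvκ p)).SplittingClass ≃ GalSect.KxHat (curveκ' p)) :
    ¬ ∀ g ∈ (MuTwoSetting.inversionModelκ' p).dotC (epsZInvκ p),
        Subgroup.Commensurable (MulAut.conj g • (dotCCuspκ'OfTrivialisation p (epsZInvκ p) eK).pair.D)
            (dotCCuspκ'OfTrivialisation p (epsZInvκ p) eK).pair.D →
          g ∈ (dotCCuspκ'OfTrivialisation p (epsZInvκ p) eK).pair.D :=
  not_commTerminalC_inversionModelκ'_epsZInvκ p

/-- **C7d HOLDS at `(inversionModelκ′, ε_Z = a·b)` for `D := inclX(D_x)`**: over `Π^tp_Ċ = dotC (inclX(inl(ab)))` every element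
commensurating `inclX(D_x)` lies in it (inputs: p447351's `X`-level terminality, `D_x ≤ Π^tp_Ẍ`, `g₁ ∉ Π^tp_Ċ`).
[cite: MochizukiSemiAnbd2006, Thm 6.5 (ii) p.71] -/
theorem commTerminalC_inversionModelκ'_epsZab :
    ∀ g ∈ (MuTwoSetting.inversionModelκ' p).dotC
        ((MuTwoSetting.inversionModelκ' p).inclX (SemidirectProduct.inl (gfpOf (FreeGroup.of 0 * FreeGroup.of 1)))),
      Subgroup.Commensurable (MulAut.conj g • (cuspDecompκ p).map (MuTwoSetting.inversionModelκ' p).inclX)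
          ((cuspDecompκ p).map (MuTwoSetting.inversionModelκ' p).inclX) →
        g ∈ (cuspDecompκ p).map (MuTwoSetting.inversionModelκ' p).inclX :=
  MuTwoSetting.commTerminalC_of_sqrt_not_mem_dotC (isCommensurablyTerminal_cuspDecompκ p)
    (epsPM_conj_inclX_of_mem_cuspDecompκ p) (cuspDecompκ_le_Xddκ p) (sqrtCuspκ_not_mem_dotC_epsZab p)

/-- The same for the `DotCCusp` TERM `dotCCuspκ'OfTrivialisation p (inclX(inl(ab))) eK`: its `pair.D` SATISFIES the proposed field C7d.
[cite: MochizukiEtTh2009, Thm 1.10 (iii) p.30] -/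
theorem commTerminalC_dotCCuspκ'OfTrivialisation_epsZab
    (eK : ((GalSect.cuspPairOf (curveκ' p) ()).pushforward (inclInvκ p)).SplittingClass ≃ GalSect.KxHat (curveκ' p)) :
    ∀ g ∈ (MuTwoSetting.inversionModelκ' p).dotC
        ((MuTwoSetting.inversionModelκ' p).inclX (SemidirectProduct.inl (gfpOf (FreeGroup.of 0 * FreeGroup.of 1)))),
      Subgroup.Commensurable
          (MulAut.conj g • (dotCCuspκ'OfTrivialisation p
            ((MuTwoSetting.inversionModelκ' p).inclX (SemidirectProduct.inl (gfpOf (FreeGroup.of 0 * FreeGroup.of 1)))) eK).pair.D)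
          (dotCCuspκ'OfTrivialisation p
            ((MuTwoSetting.inversionModelκ' p).inclX (SemidirectProduct.inl (gfpOf (FreeGroup.of 0 * FreeGroup.of 1)))) eK).pair.D →
        g ∈ (dotCCuspκ'OfTrivialisation p
          ((MuTwoSetting.inversionModelκ' p).inclX (SemidirectProduct.inl (gfpOf (FreeGroup.of 0 * FreeGroup.of 1)))) eK).pair.D :=
  commTerminalC_inversionModelκ'_epsZab p

/-- **THE CRITERION at `inversionModelκ′`, for every `ε_Z`**: C7d for `inclX(D_x)` over `dotC εZ` ⇔ `g₁ ∉ dotC εZ`.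
[cite: MochizukiSemiAnbd2006, Thm 6.5 (ii) p.71] -/
theorem commTerminalC_inversionModelκ'_iff (εZ : (MuTwoSetting.inversionModelκ' p).GtpC) :
    (∀ g ∈ (MuTwoSetting.inversionModelκ' p).dotC εZ,
        Subgroup.Commensurable (MulAut.conj g • (cuspDecompκ p).map (MuTwoSetting.inversionModelκ' p).inclX)
            ((cuspDecompκ p).map (MuTwoSetting.inversionModelκ' p).inclX) →
          g ∈ (cuspDecompκ p).map (MuTwoSetting.inversionModelκ' p).inclX) ↔
      (MuTwoSetting.inversionModelκ' p).inclX (SemidirectProduct.inl (gfpOf (FreeGroup.of 0 * FreeGroup.of 1))) *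
          (MuTwoSetting.inversionModelκ' p).epsPM ∉ (MuTwoSetting.inversionModelκ' p).dotC εZ :=
  MuTwoSetting.commTerminalC_iff_sqrt_not_mem_dotC (isCommensurablyTerminal_cuspDecompκ p)
    (epsPM_conj_inclX_of_mem_cuspDecompκ p) (cuspDecompκ_le_Xddκ p) εZ

/-- **Census form**: at the commutator-axis carrier the C7d clause is CONSISTENT with the rest of `DotCCusp` (witness `ε_Z = a·b`) and
INDEPENDENT of it (counter-witness `ε_Z = a`), both `ε_Z` admissible. [cite: MochizukiEtTh2009, Thm 1.10 (iii) p.30] -/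
theorem exists_admissible_commTerminalC_and_exists_admissible_not :
    (∃ εZ, (MuTwoSetting.inversionModelκ' p).IsAdmissibleEpsZ εZ ∧
      ∀ g ∈ (MuTwoSetting.inversionModelκ' p).dotC εZ,
        Subgroup.Commensurable (MulAut.conj g • (cuspDecompκ p).map (MuTwoSetting.inversionModelκ' p).inclX)
            ((cuspDecompκ p).map (MuTwoSetting.inversionModelκ' p).inclX) →
          g ∈ (cuspDecompκ p).map (MuTwoSetting.inversionModelκ' p).inclX) ∧
    (∃ εZ, (MuTwoSetting.inversionModelκ' p).IsAdmissibleEpsZ εZ ∧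
      ¬ ∀ g ∈ (MuTwoSetting.inversionModelκ' p).dotC εZ,
        Subgroup.Commensurable (MulAut.conj g • (cuspDecompκ p).map (MuTwoSetting.inversionModelκ' p).inclX)
            ((cuspDecompκ p).map (MuTwoSetting.inversionModelκ' p).inclX) →
          g ∈ (cuspDecompκ p).map (MuTwoSetting.inversionModelκ' p).inclX) :=
  ⟨⟨_, isAdmissibleEpsZ_abκ p, commTerminalC_inversionModelκ'_epsZab p⟩,
    ⟨_, MuTwoSetting.inversionModelκ'_isAdmissibleEpsZ p, not_commTerminalC_inversionModelκ'_epsZInvκ p⟩⟩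

end SettingModel

end Literature.AnabelianGeometry.EtaleTheta

end
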